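import Literature.NumberTheory.EllipticCurves.TateCurve.UniformizationTheta
import HarnessLib

/-!
# The zero set of the `p`-adic theta function is exactly `q^ℤ`
# (Silverman ATAEC Prop. V.3.2, analytic layer U-D' continued)

J. H. Silverman, *Advanced Topics in the Arithmetic of Elliptic Curves*, GTM 151, Prop. V.3.2,
PDF p. 399 [cite: SilvermanATAEC1994, Prop. V.3.2 (a) (PDF p. 399)], `θ(u,q) = (1−u) ∏_{n≥1}
(1−qⁿu)(1−qⁿu⁻¹)/(1−qⁿ)²`: the product "converges for all `u, q` with `|q| < 1`" and — as used
throughout §V.4 and in Prop. V.3.2 (b), where `θ` appears in denominators — it vanishes exactly on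
`q^ℤ`: each factor `1 − qⁿu^{±1}` vanishes only for `u = q^{∓n}`, and a convergent product
`∏ (1 + fᵢ)` with `Σ ‖fᵢ‖ < ∞` and no vanishing factor is nonzero.

Continuation of `UniformizationTheta.lean` (split with abc-iut-L2-t5).  Over a complete normed FIELD
`L` with `‖q‖ < 1`, `q ≠ 0`:

* `tprod_one_add_ne_zero` — general: `Σ ‖fᵢ‖ < ∞`, `∀ i, 1 + fᵢ ≠ 0` ⟹ `∏' (1 + fᵢ) ≠ 0`;
* `tateP_ne_zero_iff` : `P(v) ≠ 0 ↔ ∀ n, q^{n+1} v ≠ 1`; `tateP_one_ne_zero`;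
* `tateTheta_eq_zero_iff` : `θ(u,q) = 0 ↔ ∃ k : ℤ, u = qᵏ`.

Classical; nothing here concerns the disputed parts of the IUT corpus.  Seat abc-iut-L2-t6.
-/

noncomputable section

namespace Literature.NumberTheory.EllipticCurves.TateCurve

open Filter Topology

/-! ### A convergent product of nonzero factors is nonzero -/

section General

variable {L : Type*} [NormedField L] [CompleteSpace L] {ι : Type*}

/-- **In a complete normed field, `∏' i, (1 + f i) ≠ 0`** when `Σ ‖f i‖ < ∞` and no factor
vanishes: beyond a finite set the partial products stay within `1/2` of `1`, so all large partial
products have norm `≥ ‖∏_{s} (1+f i)‖/2 > 0`, and so does the limit.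
[cite: SilvermanATAEC1994, Prop. V.3.2 (a) (PDF p. 399)] -/
theorem tprod_one_add_ne_zero {f : ι → L} (hf : Summable fun i => ‖f i‖)
    (h : ∀ i, 1 + f i ≠ 0) : ∏' i, (1 + f i) ≠ 0 := by
  classical
  obtain ⟨s, hs⟩ := prod_vanishing_of_summable_norm hf one_half_pos
  have hP : HasProd (fun i => 1 + f i) (∏' i, (1 + f i)) :=
    (multipliable_one_add_of_summable hf).hasProd
  -- the finite product over `s` is nonzero
  have hs0 : 0 < ‖∏ i ∈ s, (1 + f i)‖ :=
    norm_pos_iff.mpr (Finset.prod_ne_zero_iff.mpr fun i _ => h i)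
  -- eventually (for finsets `T ⊇ s`) the partial product has norm `≥ ‖∏_s‖ / 2`
  have hev : ∀ᶠ T : Finset ι in atTop, ‖∏ i ∈ s, (1 + f i)‖ / 2 ≤ ‖∏ i ∈ T, (1 + f i)‖ := by
    refine Filter.eventually_atTop.mpr ⟨s, fun T hT => ?_⟩
    have hsplit : ∏ i ∈ T, (1 + f i) = (∏ i ∈ s, (1 + f i)) * ∏ i ∈ T \ s, (1 + f i) := by
      rw [← Finset.prod_union Finset.disjoint_sdiff, Finset.union_sdiff_of_subset hT]
    have htail : 1 / 2 ≤ ‖∏ i ∈ T \ s, (1 + f i)‖ := by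
      have h1 := hs (T \ s) Finset.sdiff_disjoint
      have h2 := norm_sub_norm_le (1 : L) (∏ i ∈ T \ s, (1 + f i))
      rw [norm_one, norm_sub_rev] at h2
      linarith
    rw [hsplit, norm_mul]
    calc ‖∏ i ∈ s, (1 + f i)‖ / 2 = ‖∏ i ∈ s, (1 + f i)‖ * (1 / 2) := by ring
      _ ≤ ‖∏ i ∈ s, (1 + f i)‖ * ‖∏ i ∈ T \ s, (1 + f i)‖ :=
          mul_le_mul_of_nonneg_left htail (norm_nonneg _)
  have hT : Tendsto (fun T : Finset ι => ∏ i ∈ T, (1 + f i)) atTop (𝓝 (∏' i, (1 + f i))) := by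
    have := hP
    unfold HasProd at this
    rwa [SummationFilter.unconditional_filter] at this
  have hge : ‖∏ i ∈ s, (1 + f i)‖ / 2 ≤ ‖∏' i, (1 + f i)‖ :=
    ge_of_tendsto ((continuous_norm.tendsto _).comp hT) hev
  intro h0
  rw [h0, norm_zero] at hge
  linarith

end General

/-! ### `P(v) ≠ 0` and the zero set of `θ` -/

section Zeros

variable {L : Type*} [NormedField L] [CompleteSpace L] {q : L}

/-- `P(v) = 0 ↔` some factor vanishes, i.e. `q^{n+1} v = 1` for some `n`.
[cite: SilvermanATAEC1994, Prop. V.3.2 (a) (PDF p. 399)] -/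
theorem tateP_eq_zero_iff (hq : ‖q‖ < 1) (v : L) :
    tateP q v = 0 ↔ ∃ n : ℕ, q ^ (n + 1) * v = 1 := by
  constructor
  · intro h0
    by_contra hne
    push Not at hne
    have h : (fun n : ℕ => 1 - q ^ (n + 1) * v) = fun n : ℕ => 1 + -(q ^ (n + 1) * v) := by
      funext n; ring
    have := tprod_one_add_ne_zero (summable_norm_pow_succ_mul hq v) (fun n => by
      rw [← sub_eq_add_neg, sub_ne_zero]; exact (hne n).symm)
    rw [← h] at this
    exact this h0
  · rintro ⟨n, hn⟩
    exact tprod_of_exists_eq_zero ⟨n, by rw [hn, sub_self]⟩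

/-- `P(1) ≠ 0` for `‖q‖ < 1` (`q^{n+1} ≠ 1`). [cite: SilvermanATAEC1994, Prop. V.3.2 (a) (PDF p. 399)] -/
theorem tateP_one_ne_zero (hq : ‖q‖ < 1) : tateP q (1 : L) ≠ 0 := by
  rw [Ne, tateP_eq_zero_iff hq]
  rintro ⟨n, hn⟩
  rw [mul_one] at hn
  have := congrArg (‖·‖) hn
  simp only [norm_pow, norm_one] at this
  exact absurd this (ne_of_lt (pow_lt_one₀ (norm_nonneg q) hq (Nat.succ_ne_zero n)))

/-- **The zero set of `θ` is `q^ℤ`**: for `‖q‖ < 1`, `q ≠ 0` (complete normed field),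
`θ(u,q) = 0 ↔ u ∈ q^ℤ` — the factor `1 − u` (`u = q⁰`), the factors `1 − qⁿu⁻¹` (`u = qⁿ`,
`n ≥ 1`) and `1 − qⁿu` (`u = q⁻ⁿ`). [cite: SilvermanATAEC1994, Prop. V.3.2 (a) (PDF p. 399)] -/
theorem tateTheta_eq_zero_iff (hq : ‖q‖ < 1) (hq0 : q ≠ 0) (u : L) :
    tateTheta q u = 0 ↔ ∃ k : ℤ, u = q ^ k := by
  constructor
  · intro h
    unfold tateTheta at h
    rw [div_eq_zero_iff, mul_eq_zero, mul_eq_zero, pow_eq_zero_iff two_ne_zero] at h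
    rcases h with ((h1 | h2) | h3) | h4
    · exact ⟨0, by rw [zpow_zero]; exact (sub_eq_zero.mp h1).symm⟩
    · obtain ⟨n, hn⟩ := (tateP_eq_zero_iff hq u).mp h2
      refine ⟨-((n : ℤ) + 1), ?_⟩
      rw [zpow_neg, ← Nat.cast_succ, zpow_natCast]
      exact (eq_inv_of_mul_eq_one_right hn)
    · obtain ⟨n, hn⟩ := (tateP_eq_zero_iff hq u⁻¹).mp h3
      refine ⟨(n : ℤ) + 1, ?_⟩
      rw [← Nat.cast_succ, zpow_natCast]
      exact inv_injective (eq_inv_of_mul_eq_one_right hn)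
    · exact absurd h4 (tateP_one_ne_zero hq)
  · rintro ⟨k, rfl⟩
    exact tateTheta_zpow hq hq0 k

/-- `θ(u,q) ≠ 0` off `q^ℤ`. [cite: SilvermanATAEC1994, Prop. V.3.2 (a) (PDF p. 399)] -/
theorem tateTheta_ne_zero (hq : ‖q‖ < 1) (hq0 : q ≠ 0) {u : L} (hu : ∀ k : ℤ, u ≠ q ^ k) :
    tateTheta q u ≠ 0 := fun h =>
  let ⟨k, hk⟩ := (tateTheta_eq_zero_iff hq hq0 u).mp h
  hu k hk

end Zeros

end Literature.NumberTheory.EllipticCurves.TateCurve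

end
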